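import Mathlib.Algebra.Group.ForwardDiff
import Mathlib.RingTheory.Polynomial.Pochhammer
import Mathlib.Analysis.Calculus.Deriv.Polynomial
import Mathlib.Analysis.Calculus.IteratedDeriv.Lemmas
import Mathlib.Analysis.Calculus.ContDiff.Operations
import Mathlib.Analysis.Normed.Group.Bounded
import Mathlib.Data.Nat.Choose.Basic
import HarnessLib

/-!
# Newton's forward-difference interpolation polynomial: nodal values and derivative bounds on the window

Topic `Literature/Analysis/Calculus`.  Given `N + 1` equally spaced nodes `t₀, t₀ + δ, …, t₀ + Nδ`
(`δ > 0`) and values `f 0, …, f N` in a real normed space, the **Gregory–Newton forward-difference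
interpolation polynomial**

  `P(s) = Σ_{k=0}^{N} q_k((s - t₀)/δ) • (Δ^k f)(0)`,   `q_k(u) = u(u-1)⋯(u-k+1)/k!`

(Newton 1687 / Gregory 1670; Hildebrand, *Introduction to Numerical Analysis*, 2nd ed., §4.3,
"Newton's forward-difference formula" (4.3.5): `f_s = f₀ + sΔf₀ + s(s-1)/2! Δ²f₀ + ⋯ + s(s-1)⋯(s-n+1)/n! Δⁿf₀`,
`s = (x - x₀)/h`, PDF p. 114 of the held Dover reprint) takes the value `f j` at the node `t₀ + jδ`
(`j ≤ N`; this is Mathlib's Gregory–Newton formula `shift_eq_sum_fwdDiff_iter`), reproduces constants,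
commutes with continuous linear maps, and — the estimate this file exists for — its `l`-th
derivative on the window `[t₀, t₀ + Nδ]` is controlled by the forward differences of ORDER `≥ l` only:

  `‖P^{(l)}(s)‖ ≤ B_N δ^{-l} Σ_{k=l}^{N} ‖(Δ^k f)(0)‖`   (`s ∈ [t₀, t₀ + Nδ]`, `l ≤ N`),

with `B_N` depending on `N` alone (the basis polynomial `q_k` has degree `k`, so `q_k^{(l)} = 0` for
`k < l`, and `|q_k^{(l)}| ≤ B_N` on `[0, N]` by compactness).  USE (Benfatto–Giuliani–Mastropietro 2006,
§2.3 (2.36)/(2.36aa) with footnote ¹, §2.5 proof of Lemma 2.2): a function known only on a lattice of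
step `δ = 2π/β` (the Matsubara frequencies), with bounds on its DISCRETE derivatives
`(δ⁻¹Δ)^a`, is replaced on each `(N+1)`-node window by `P`, a genuinely smooth function with the same
nodal values and honest derivative bounds of the same size; discrete `N`-th differences of any smooth
expression in the function are then discrete differences of the same expression in `P`, which the
`N`-fold mean value theorem (`IteratedDifferenceDerivBound.lean`) bounds by `δ^N sup |∂^N|`.

PROVED here:

* `newtonBasis k` (definition `q_k = descPochhammer/k!`), `newtonBasis_natCast` (`q_k(j) = C(j,k)`),
  `contDiff_newtonBasis`, `iteratedDeriv_newtonBasis_eq_zero` (`k < l ⇒ q_k^{(l)} ≡ 0`),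
  `exists_bound_iteratedDeriv_newtonBasis` (`|q_k^{(l)}| ≤ B_N` on `[0, N]`, `k, l ≤ N`);
* `newtonInterpolant N f t₀ δ` (definition), `newtonInterpolant_node` (`P(t₀ + jδ) = f j`, `j ≤ N`),
  `contDiff_newtonInterpolant`, `newtonInterpolant_const`, `newtonInterpolant_add/_sub/_const_smul`,
  `ContinuousLinearMap.map_newtonInterpolant` (`L (P f s) = P (L ∘ f) s`);
* `iteratedDeriv_newtonInterpolant` (the derivative formula) and
  **`exists_norm_iteratedDeriv_newtonInterpolant_le`** — the window bound displayed above.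

## Sources

F. B. Hildebrand, *Introduction to Numerical Analysis*, 2nd ed. (McGraw-Hill 1974; Dover reprint 1987),
§4.3 "Newton's forward-difference formula" (4.3.2)–(4.3.5), PDF p. 114 of the held copy
`book:hildebrand1987-introduction-numerical-analysis-2nd-edition` [Hildebrand1987]; the use: G. Benfatto, A. Giuliani, V. Mastropietro, Ann. Henri Poincaré **7** (2006) 809–898,
§2.3 (2.36aa) and footnote ¹, §2.5 proof of Lemma 2.2 (2.56) [BenfattoGiulianiMastropietro2006].
The estimates are routine ("folklore"); Mathlib supplies `descPochhammer`, `shift_eq_sum_fwdDiff_iter`.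
-/

noncomputable section

open Finset Polynomial
open scoped Nat

namespace Literature.Analysis.Calculus

/-! ### The Newton basis polynomials `q_k(u) = u(u-1)⋯(u-k+1)/k!` -/

/-- **The Newton basis function** `q_k(u) = u(u-1)⋯(u-k+1)/k!` (`descPochhammer ℝ k / k!`), the
coefficient of `Δ^k f(0)` in the Gregory–Newton formula. [cite: Hildebrand1987, §4.3 (4.3.5) p.114] -/
def newtonBasis (k : ℕ) (u : ℝ) : ℝ := (descPochhammer ℝ k).eval u / (k ! : ℝ)

/-- At a natural number `q_k(j) = C(j, k)` (`= 0` for `j < k`). [cite: Hildebrand1987, §4.3 (4.3.5) p.114] -/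
theorem newtonBasis_natCast (k j : ℕ) : newtonBasis k (j : ℝ) = (j.choose k : ℝ) := by
  rw [newtonBasis, descPochhammer_eval_eq_descFactorial ℝ j k, Nat.descFactorial_eq_factorial_mul_choose]
  have hk : (k ! : ℝ) ≠ 0 := by exact_mod_cast k.factorial_ne_zero
  push_cast
  field_simp

/-- `q_0 ≡ 1`. [cite: Hildebrand1987, §4.3 (4.3.5) p.114] -/
theorem newtonBasis_zero (u : ℝ) : newtonBasis 0 u = 1 := by
  simp [newtonBasis]

/-- The evaluation of a real polynomial is smooth. [folklore] -/
private theorem contDiff_polynomial_eval (p : ℝ[X]) {n : WithTop ℕ∞} : ContDiff ℝ n fun u : ℝ => p.eval u := by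
  have h : (fun u : ℝ => p.eval u) = fun u => ∑ i ∈ range (p.natDegree + 1), p.coeff i * u ^ i := by
    funext u; exact p.eval_eq_sum_range u
  rw [h]
  exact ContDiff.sum fun i _ => contDiff_const.mul (contDiff_id.pow i)

/-- `q_k` is smooth. [cite: Hildebrand1987, §4.3 (4.3.5) p.114] -/
theorem contDiff_newtonBasis (k : ℕ) {n : WithTop ℕ∞} : ContDiff ℝ n (newtonBasis k) :=
  (contDiff_polynomial_eval _).div_const _

/-- Iterated derivatives of a polynomial function are the evaluations of the iterated formal
derivatives. [folklore] -/
private theorem iteratedDeriv_polynomial_eval (p : ℝ[X]) :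
    ∀ l : ℕ, iteratedDeriv l (fun u : ℝ => p.eval u) = fun u => (derivative^[l] p).eval u
  | 0 => by simp
  | l + 1 => by
    rw [iteratedDeriv_succ, iteratedDeriv_polynomial_eval p l, Function.iterate_succ_apply']
    funext u
    exact Polynomial.deriv _

/-- **`q_k` has degree `k`, so its derivatives of order `l > k` vanish.** [cite: Hildebrand1987, §4.3 (4.3.5) p.114] -/
theorem iteratedDeriv_newtonBasis_eq_zero {k l : ℕ} (h : k < l) : iteratedDeriv l (newtonBasis k) = 0 := by
  have hfun : newtonBasis k = fun u => (C ((k ! : ℝ)⁻¹) * descPochhammer ℝ k).eval u := by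
    funext u; rw [newtonBasis, eval_mul, eval_C]; ring
  rw [hfun, iteratedDeriv_polynomial_eval]
  have hdeg : (C ((k ! : ℝ)⁻¹) * descPochhammer ℝ k).natDegree < l :=
    lt_of_le_of_lt ((natDegree_C_mul_le _ _).trans (descPochhammer_natDegree ℝ k).le) h
  funext u
  rw [iterate_derivative_eq_zero hdeg, eval_zero, Pi.zero_apply]

/-- **Uniform bound for the derivatives of the basis on the window**: there is `B = B_N ≥ 0` with
`|q_k^{(l)}(u)| ≤ B` for all `k, l ≤ N` and `u ∈ [0, N]` (continuity on a compact interval).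
[cite: Hildebrand1987, §4.3 (4.3.5) p.114] -/
theorem exists_bound_iteratedDeriv_newtonBasis (N : ℕ) :
    ∃ B : ℝ, 0 ≤ B ∧ ∀ k, k ≤ N → ∀ l, l ≤ N → ∀ u ∈ Set.Icc (0 : ℝ) N, ‖iteratedDeriv l (newtonBasis k) u‖ ≤ B := by
  have hkl : ∀ k l : ℕ, ∃ b : ℝ, ∀ u ∈ Set.Icc (0 : ℝ) N, ‖iteratedDeriv l (newtonBasis k) u‖ ≤ b := fun k l =>
    isCompact_Icc.exists_bound_of_continuousOn
      (((contDiff_newtonBasis k (n := l)).continuous_iteratedDeriv' l).continuousOn)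
  choose b hb using hkl
  refine ⟨∑ k ∈ range (N + 1), ∑ l ∈ range (N + 1), |b k l|, sum_nonneg fun _ _ => sum_nonneg fun _ _ => abs_nonneg _,
    fun k hk l hl u hu => ?_⟩
  calc ‖iteratedDeriv l (newtonBasis k) u‖ ≤ b k l := hb k l u hu
    _ ≤ |b k l| := le_abs_self _
    _ ≤ ∑ l' ∈ range (N + 1), |b k l'| :=
        single_le_sum (f := fun l' => |b k l'|) (fun _ _ => abs_nonneg _) (mem_range.2 (by omega))
    _ ≤ ∑ k' ∈ range (N + 1), ∑ l' ∈ range (N + 1), |b k' l'| :=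
        single_le_sum (f := fun k' => ∑ l' ∈ range (N + 1), |b k' l'|)
          (fun _ _ => sum_nonneg fun _ _ => abs_nonneg _) (mem_range.2 (by omega))

/-! ### The interpolation polynomial -/

variable {E : Type*} [NormedAddCommGroup E] [NormedSpace ℝ E]

omit [NormedSpace ℝ E] in
/-- Iterated forward differences of the zero function vanish. [folklore] -/
private theorem fwdDiff_iter_zero_fun {M : Type*} [AddCommMonoid M] (h : M) (k : ℕ) :
    (fwdDiff h)^[k] (fun _ : M => (0 : E)) = fun _ => 0 := by
  induction k with
  | zero => rfl
  | succ k ih => rw [Function.iterate_succ_apply, fwdDiff_const]; exact ih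

/-- **Newton's forward-difference interpolation polynomial** through the nodes `t₀ + jδ`, `j = 0,…,N`, of
the data `f 0, …, f N`: `P(s) = Σ_{k=0}^{N} q_k((s - t₀)/δ) • (Δ^k f)(0)` with Mathlib's forward
difference `fwdDiff 1` on `ℕ`. [cite: Hildebrand1987, §4.3 (4.3.5) p.114] -/
def newtonInterpolant (N : ℕ) (f : ℕ → E) (t₀ δ : ℝ) (s : ℝ) : E :=
  ∑ k ∈ range (N + 1), newtonBasis k ((s - t₀) / δ) • ((fwdDiff (1 : ℕ))^[k] f 0)

/-- **Nodal values (Gregory–Newton)**: `P(t₀ + jδ) = f j` for `j ≤ N` (`δ ≠ 0`).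
[cite: Hildebrand1987, §4.3 (4.3.5) p.114] -/
theorem newtonInterpolant_node (N : ℕ) (f : ℕ → E) (t₀ : ℝ) {δ : ℝ} (hδ : δ ≠ 0) {j : ℕ} (hj : j ≤ N) :
    newtonInterpolant N f t₀ δ (t₀ + δ * j) = f j := by
  have hu : (t₀ + δ * j - t₀) / δ = (j : ℝ) := by field_simp; ring
  unfold newtonInterpolant
  simp_rw [hu, newtonBasis_natCast, Nat.cast_smul_eq_nsmul ℝ]
  -- Gregory–Newton: `f j = Σ_{k ≤ j} C(j,k) Δ^k f 0`; the terms `j < k ≤ N` vanish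
  have hGN := shift_eq_sum_fwdDiff_iter (1 : ℕ) f j 0
  rw [zero_add, smul_eq_mul, mul_one] at hGN
  rw [hGN]
  symm
  refine sum_subset (range_subset_range.2 (by omega)) fun k hk hkj => ?_
  rw [Finset.mem_range] at hk hkj
  rw [Nat.choose_eq_zero_of_lt (by omega), zero_smul]

/-- The interpolant is smooth. [cite: Hildebrand1987, §4.3 (4.3.5) p.114] -/
theorem contDiff_newtonInterpolant (N : ℕ) (f : ℕ → E) (t₀ δ : ℝ) {n : WithTop ℕ∞} :
    ContDiff ℝ n (newtonInterpolant N f t₀ δ) := by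
  unfold newtonInterpolant
  refine ContDiff.sum fun k _ => ContDiff.smul ?_ contDiff_const
  exact (contDiff_newtonBasis k).comp ((contDiff_id.sub contDiff_const).div_const δ)

/-- **Constants are reproduced**: the interpolant of a constant sequence is that constant.
[cite: Hildebrand1987, §4.3 (4.3.5) p.114] -/
theorem newtonInterpolant_const (N : ℕ) (c : E) (t₀ δ s : ℝ) : newtonInterpolant N (fun _ => c) t₀ δ s = c := by
  unfold newtonInterpolant
  rw [sum_range_succ', Function.iterate_zero, id, newtonBasis_zero, one_smul]
  have hz : ∀ k ∈ range N, newtonBasis (k + 1) ((s - t₀) / δ) • ((fwdDiff (1 : ℕ))^[k + 1] (fun _ : ℕ => c) 0) = 0 := by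
    intro k _
    rw [Function.iterate_succ_apply, fwdDiff_const, fwdDiff_iter_zero_fun, smul_zero]
  rw [sum_eq_zero hz, zero_add]

/-- Additivity in the data. [cite: Hildebrand1987, §4.3 (4.3.5) p.114] -/
theorem newtonInterpolant_add (N : ℕ) (f g : ℕ → E) (t₀ δ s : ℝ) :
    newtonInterpolant N (f + g) t₀ δ s = newtonInterpolant N f t₀ δ s + newtonInterpolant N g t₀ δ s := by
  unfold newtonInterpolant
  rw [← sum_add_distrib]
  refine sum_congr rfl fun k _ => ?_
  rw [fwdDiff_iter_add, Pi.add_apply, smul_add]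

/-- Homogeneity in the data. [cite: Hildebrand1987, §4.3 (4.3.5) p.114] -/
theorem newtonInterpolant_const_smul (N : ℕ) (r : ℝ) (f : ℕ → E) (t₀ δ s : ℝ) :
    newtonInterpolant N (r • f) t₀ δ s = r • newtonInterpolant N f t₀ δ s := by
  unfold newtonInterpolant
  rw [smul_sum]
  refine sum_congr rfl fun k _ => ?_
  rw [fwdDiff_iter_const_smul, Pi.smul_apply, smul_comm]

/-- The interpolant of `f - g`. [cite: Hildebrand1987, §4.3 (4.3.5) p.114] -/
theorem newtonInterpolant_sub (N : ℕ) (f g : ℕ → E) (t₀ δ s : ℝ) :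
    newtonInterpolant N (f - g) t₀ δ s = newtonInterpolant N f t₀ δ s - newtonInterpolant N g t₀ δ s := by
  rw [sub_eq_add_neg, newtonInterpolant_add, ← neg_one_smul ℝ g, newtonInterpolant_const_smul, neg_one_smul,
    sub_eq_add_neg]

/-- Distance to a constant: `P f (s) - c` is the interpolant of `f - c`. [cite: Hildebrand1987, §4.3 (4.3.5) p.114] -/
theorem newtonInterpolant_sub_const (N : ℕ) (f : ℕ → E) (c : E) (t₀ δ s : ℝ) :
    newtonInterpolant N f t₀ δ s - c = newtonInterpolant N (fun n => f n - c) t₀ δ s := by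
  have hfc : (fun n => f n - c) = f - fun _ => c := rfl
  rw [hfc, newtonInterpolant_sub, newtonInterpolant_const]

/-- Iterated forward differences commute with continuous linear maps. [folklore] -/
private theorem map_fwdDiff_iter {F : Type*} [NormedAddCommGroup F] [NormedSpace ℝ F] (L : E →L[ℝ] F)
    (f : ℕ → E) (k n : ℕ) :
    L (((fwdDiff (1 : ℕ))^[k] f) n) = ((fwdDiff (1 : ℕ))^[k] (fun m => L (f m))) n := by
  rw [fwdDiff_iter_eq_sum_shift, fwdDiff_iter_eq_sum_shift, map_sum]
  refine sum_congr rfl fun i _ => ?_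
  rw [map_zsmul]

/-- **Continuous linear maps commute with interpolation**: `L (P f s) = P (L ∘ f) s` (e.g. the real
part of a complex-valued interpolant is the interpolant of the real parts). [cite: Hildebrand1987, §4.3 (4.3.5) p.114] -/
theorem _root_.ContinuousLinearMap.map_newtonInterpolant {F : Type*} [NormedAddCommGroup F] [NormedSpace ℝ F]
    (L : E →L[ℝ] F) (N : ℕ) (f : ℕ → E) (t₀ δ s : ℝ) :
    L (newtonInterpolant N f t₀ δ s) = newtonInterpolant N (fun n => L (f n)) t₀ δ s := by
  unfold newtonInterpolant
  rw [map_sum]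
  refine sum_congr rfl fun k _ => ?_
  rw [L.map_smul, map_fwdDiff_iter L]

/-! ### Derivatives on the window -/

/-- **The derivative formula**: `P^{(l)}(s) = Σ_k δ^{-l} q_k^{(l)}((s - t₀)/δ) • Δ^k f(0)`.
[cite: Hildebrand1987, §4.3 (4.3.5) p.114] -/
theorem iteratedDeriv_newtonInterpolant (N : ℕ) (f : ℕ → E) (t₀ δ : ℝ) (l : ℕ) (s : ℝ) :
    iteratedDeriv l (newtonInterpolant N f t₀ δ) s =
      ∑ k ∈ range (N + 1), (δ⁻¹ ^ l * iteratedDeriv l (newtonBasis k) ((s - t₀) / δ)) • ((fwdDiff (1 : ℕ))^[k] f 0) := by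
  have hb : ∀ k, ContDiff ℝ l (fun s : ℝ => newtonBasis k ((s - t₀) / δ)) := fun k =>
    (contDiff_newtonBasis k).comp ((contDiff_id.sub contDiff_const).div_const δ)
  have hfun : newtonInterpolant N f t₀ δ =
      fun s => ∑ k ∈ range (N + 1), newtonBasis k ((s - t₀) / δ) • ((fwdDiff (1 : ℕ))^[k] f 0) := rfl
  rw [hfun, iteratedDeriv_fun_sum (f := fun k s => newtonBasis k ((s - t₀) / δ) • ((fwdDiff (1 : ℕ))^[k] f 0))
    fun k _ => ((hb k).smul contDiff_const).contDiffAt]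
  refine sum_congr rfl fun k _ => ?_
  rw [iteratedDeriv_smul_const (hb k).contDiffAt]
  congr 1
  -- the affine change of variables `u = δ⁻¹ (s - t₀)`
  have h1 : (fun s : ℝ => newtonBasis k ((s - t₀) / δ)) = fun s => (fun x => newtonBasis k (δ⁻¹ * x)) (s - t₀) := by
    funext s; simp only [div_eq_inv_mul]
  rw [h1, iteratedDeriv_comp_sub_const l (fun x => newtonBasis k (δ⁻¹ * x)) t₀,
    iteratedDeriv_comp_const_mul (contDiff_newtonBasis k) δ⁻¹]
  simp only [div_eq_inv_mul]

/-- **Derivative bounds on the window** (the estimate this file exists for): there is `B = B_N ≥ 0`,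
depending on `N` only, such that for every data sequence `f`, base point `t₀`, step `δ > 0`, order
`l ≤ N` and point `s ∈ [t₀, t₀ + Nδ]`:
`‖P^{(l)}(s)‖ ≤ B δ^{-l} Σ_{k=l}^{N} ‖(Δ^k f)(0)‖` — only the differences of order `≥ l` enter.
[cite: Hildebrand1987, §4.3 (4.3.5) p.114] -/
theorem exists_norm_iteratedDeriv_newtonInterpolant_le (E : Type*) [NormedAddCommGroup E] [NormedSpace ℝ E]
    (N : ℕ) :
    ∃ B : ℝ, 0 ≤ B ∧ ∀ (f : ℕ → E) (t₀ δ : ℝ), 0 < δ → ∀ l, l ≤ N → ∀ s ∈ Set.Icc t₀ (t₀ + δ * N),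
      ‖iteratedDeriv l (newtonInterpolant N f t₀ δ) s‖ ≤
        B * δ⁻¹ ^ l * ∑ k ∈ Finset.Icc l N, ‖((fwdDiff (1 : ℕ))^[k] f) 0‖ := by
  obtain ⟨B, hB0, hB⟩ := exists_bound_iteratedDeriv_newtonBasis N
  refine ⟨B, hB0, fun f t₀ δ hδ l hl s hs => ?_⟩
  have hu : (s - t₀) / δ ∈ Set.Icc (0 : ℝ) N := by
    obtain ⟨h1, h2⟩ := hs
    constructor
    · exact div_nonneg (by linarith) hδ.le
    · rw [div_le_iff₀ hδ]; linarith
  rw [iteratedDeriv_newtonInterpolant]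
  -- the terms with `k < l` vanish
  have hsplit : ∑ k ∈ range (N + 1),
      (δ⁻¹ ^ l * iteratedDeriv l (newtonBasis k) ((s - t₀) / δ)) • ((fwdDiff (1 : ℕ))^[k] f 0) =
      ∑ k ∈ Finset.Icc l N, (δ⁻¹ ^ l * iteratedDeriv l (newtonBasis k) ((s - t₀) / δ)) • ((fwdDiff (1 : ℕ))^[k] f 0) := by
    symm
    refine sum_subset (fun k hk => ?_) fun k hk hkl => ?_
    · rw [Finset.mem_Icc] at hk; rw [Finset.mem_range]; omega
    · rw [Finset.mem_range] at hk
      rw [Finset.mem_Icc, not_and_or, not_le, not_le] at hkl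
      have hlt : k < l := by omega
      rw [iteratedDeriv_newtonBasis_eq_zero hlt, Pi.zero_apply, mul_zero, zero_smul]
  rw [hsplit, mul_sum]
  refine (norm_sum_le _ _).trans (sum_le_sum fun k hk => ?_)
  rw [Finset.mem_Icc] at hk
  rw [norm_smul, norm_mul, norm_pow, norm_inv, Real.norm_eq_abs, abs_of_pos hδ]
  have h1 := hB k hk.2 l hl _ hu
  calc δ⁻¹ ^ l * ‖iteratedDeriv l (newtonBasis k) ((s - t₀) / δ)‖ * ‖(fwdDiff 1)^[k] f 0‖
      ≤ δ⁻¹ ^ l * B * ‖(fwdDiff 1)^[k] f 0‖ := by gcongr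
    _ = B * δ⁻¹ ^ l * ‖(fwdDiff 1)^[k] f 0‖ := by ring

/-- **The sup bound on the window** (`l = 0`): `‖P(s)‖ ≤ B Σ_{k=0}^{N} ‖Δ^k f(0)‖`, and against a
constant `c`: `‖P(s) - c‖ ≤ B (‖f 0 - c‖ + Σ_{k=1}^{N} ‖Δ^k f(0)‖)`. [cite: Hildebrand1987, §4.3 (4.3.5) p.114] -/
theorem exists_norm_newtonInterpolant_sub_const_le (E : Type*) [NormedAddCommGroup E] [NormedSpace ℝ E]
    (N : ℕ) :
    ∃ B : ℝ, 0 ≤ B ∧ ∀ (f : ℕ → E) (c : E) (t₀ δ : ℝ), 0 < δ → ∀ s ∈ Set.Icc t₀ (t₀ + δ * N),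
      ‖newtonInterpolant N f t₀ δ s - c‖ ≤
        B * (‖f 0 - c‖ + ∑ k ∈ Finset.Icc 1 N, ‖((fwdDiff (1 : ℕ))^[k] f) 0‖) := by
  obtain ⟨B, hB0, hB⟩ := exists_norm_iteratedDeriv_newtonInterpolant_le E N
  refine ⟨B, hB0, fun f c t₀ δ hδ s hs => ?_⟩
  have h := hB (fun n => f n - c) t₀ δ hδ 0 (Nat.zero_le _) s hs
  rw [iteratedDeriv_zero, pow_zero, mul_one, ← newtonInterpolant_sub_const] at h
  refine h.trans (le_of_eq ?_)
  congr 1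
  rw [show Finset.Icc 0 N = insert 0 (Finset.Icc 1 N) by
      ext k; simp only [Finset.mem_insert, Finset.mem_Icc]; omega,
    sum_insert (by simp)]
  simp only [Function.iterate_zero, id_eq]
  congr 1
  refine sum_congr rfl fun k hk => ?_
  rw [Finset.mem_Icc] at hk
  obtain ⟨k', rfl⟩ : ∃ k', k = k' + 1 := ⟨k - 1, by omega⟩
  have hc : (fun n => f n - c) = f + fun _ => -c := by funext n; simp [sub_eq_add_neg]
  rw [hc, fwdDiff_iter_add, Pi.add_apply, Function.iterate_succ_apply (fwdDiff 1) k' (fun _ : ℕ => -c),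
    fwdDiff_const, fwdDiff_iter_zero_fun, add_zero]

end Literature.Analysis.Calculus

end
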